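import Mathlib.LinearAlgebra.Matrix.Hermitian
import Mathlib.LinearAlgebra.Matrix.Notation
import Mathlib.Analysis.Complex.Basic
import HarnessLib

/-!
# Barrier: the residual interval of the SECOND Ritz pair is not a certified gap — `γ₀⁻ = (Ẽ₁ − ‖r₁‖) − Ẽ₀`
# may EXCEED the true gap `γ₀ = E₁ − Ẽ₀` (an index hypothesis that residuals cannot supply is missing)

Barrier catalogue `Literature/Barriers/` (D-0021), entry `ExcitedRitzResidualNotGapCertificate`, filed
for the venture `Summits/Ventures/CertifiedQuantumChemistry` (LADDER-CHEM, HUMAN RULING D-0105 (1); rung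
X1 / door M1 of `IDIFF-SHAPE-A`: Temple–Kato lower rows need a CERTIFIED gap point `β ≤ E₁`) and equally
valid for every Temple / Kato / gap-theorem certificate of the tree (`CertifiedManyBodySolver`, the
Hubbard ladder): it says which cheap surrogate for `β` is NOT a certificate input.

HONEST FRAMING of that venture (verbatim): certified bounds for a stated model Hamiltonian in a stated
basis; not a claim about the real molecule or material beyond that model. This entry concerns the
LOGIC of one printed route to such a bound; no number is certified or disputed here.

## What is printed (page opened by this seat, 2026-08-27)

S. Upadhyay, A. Shayit, T. Zhang, S. H. Yuwono, A. E. DePrince III, X. Li, *Definitive Assessment of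
the Accuracy, Variationality, and Convergence of Relativistic Coupled Cluster and Density Matrix
Renormalization Group in 100-Orbital Space*, J. Chem. Theory Comput. 22 (2026) 4358–4366
(doi:10.1021/acs.jctc.6c00098 = arXiv:2604.02144; `UpadhyayEtAl2026`, held `paper:arxiv-2604.02144`,
chunk p0005 L3–L26), §2 "Theory", verbatim: "the gap theorem … offers the tightest lower bound,
`|δE| ≤ ‖r‖²/γ₀`, where `r` is the Ritz residual of the desired state and the gap `γ₀ ≡ E₁ − Ẽ₀` is
the difference between `E₁`, the (unknown) exact energy of the first excited state, and `Ẽ₀`, the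
computed Ritz value of the ground state. … In more pathological cases, such as ground-state
near-degeneracy, one can instead obtain an exact lower bound on the gap `γ₀` by including the
posterior error bound of the first excited state … in the Davidson calculation:
`γ₀ = E₁ − Ẽ₀ ≥ (Ẽ₁ − ‖r₁‖) − Ẽ₀ ≡ γ₀⁻`, where `r₁` is the residual associated with the Ritz value
`Ẽ₁`. Combined with the variational bound … `E₀ ≤ Ẽ₀`, one can place tight upper and lower bounds on
the true eigenvalue: `Ẽ₀ − ‖r‖²/γ₀ ≤ E₀ ≤ Ẽ₀`."

## What this entry records (everything PROVED; no named fact is introduced)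

The first display (`|δE| ≤ ‖r‖²/γ₀` GIVEN `γ₀`) is the Kato–Temple bound — in the tree as
`Literature.MathematicalPhysics.QuantumChemistry.templeInequality` (PROVED, `templeInequality_holds`)
and consumed by the venture's `TempleCertificate` / `lowerRow_of_temple`; it is not at issue. The
second display, the "exact lower bound on the gap" `γ₀ ≥ γ₀⁻`, is FALSE AS PRINTED: the posterior
(Weinstein / Kahan residual) bound on the excited Ritz pair `(Ẽ₁, u₁)` says only that the interval
`[Ẽ₁ − ‖r₁‖, Ẽ₁ + ‖r₁‖]` contains SOME eigenvalue (tree: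
`Literature.MathematicalPhysics.QuantumChemistry.exists_eigenOn_abs_sub_le_sqrt`, Horn–Johnson
Thm 6.3.14 (b)); the step "hence `E₁ ≥ Ẽ₁ − ‖r₁‖`" needs IN ADDITION that no eigenvalue of the
(symmetry-sector) matrix other than `E₀` lies below `Ẽ₁ − ‖r₁‖` — i.e. that the search space has not
missed a state below its second root: an INDEX hypothesis (an eigenvalue COUNT), which no residual
datum supplies (Cauchy interlacing gives only the opposite inequality `E₁ ≤ Ẽ₁`).

Lean rendering. `ExcitedRitzResidualGapRoute n H` is the printed route as a predicate on one finite
Hermitian matrix `H` (a `def` with parameters — nothing asserted): for an exact ground pair `(E₀, ψ₀)` (eigenpair at the bottom of the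
spectrum), two orthonormal Ritz vectors `u₀, u₁` of one search space (the compression of `H` to
`span{u₀, u₁}` is diagonal) with Ritz values `Ẽ₀ ≤ Ẽ₁`, EVERY eigenvalue `e ≠ E₀` of `H` satisfies
`Ẽ₁ − ‖r₁‖ ≤ e`, `r₁ = Hu₁ − Ẽ₁u₁` (for a non-degenerate ground state this is exactly `γ₀ ≥ γ₀⁻`;
in general it is IMPLIED by the printed sentence, so refuting it refutes the print).
`not_excitedRitzResidualGapRoute_threeLevel` / `not_forall_excitedRitzResidualGapRoute` REFUTE it and
`ExcitedRitzResidualNotGapCertificate(_holds)` records the witness in the sharpest form — BOTH Ritz pairs EXACT (zero residuals): `H = diag(0, 1, 2)` on `ℂ³`,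
search space `span{e₀, e₂}`, Ritz pairs `(0, e₀) = (E₀, ψ₀)` and `(2, e₂)`, `r₀ = r₁ = 0`, so
`γ₀⁻ = 2 − 0 = 2`, while `e₁` is an eigenvector of eigenvalue `1 ≠ E₀`: `γ₀ = 1 < γ₀⁻`. (Analysis and
witness: chem-lit-2, lit/FRESHNESS-CHEM.md §2.12 J4 (ii), 2026-08-27; typed here.)

## References

* [UpadhyayEtAl2026] as above, §2 eqs. (`|δE| ≤ ‖r‖²/γ₀`), (`γ₀ ≥ γ₀⁻`), (`Ẽ₀ − ‖r‖²/γ₀ ≤ E₀ ≤ Ẽ₀`),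
  chunk p0005. Primary of its numbers: Shayit et al., Nat. Commun. 16 (2025)
  doi:10.1038/s41467-025-65967-7, Methods "Eigenvalue bound analysis" (there `γ₀` is an X2C-CISD
  ESTIMATE — an honest surrogate, labelled as such; not at issue here).
* Tree (the doors, cited not restated): `…QuantumChemistry.exists_eigenOn_abs_sub_le_sqrt`,
  `…QuantumChemistry.le_minEnergyOn_of_enclosure_lt` (Weinstein's lower-bound sentence WITH the index
  hypothesis `λ₂ ≥ ρ`), `…QuantumChemistry.templeInequality_holds`; venture side
  `Summit.Ventures.CertifiedQuantumChemistry.GapCertificate` and its certified producers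
  `Rows/LevelShiftGapRows.lean` (`gapCertificate_of_lowerRow_levelShift`: a certified LOWER row of the
  level-shifted file), `Rows/GapCertificateCodimOne.lean` (form bound on `v^⊥`), `Rows/TempleLowerRow.lean`.
-/

namespace Literature.Barriers.CertifiedQuantumChemistry

open Matrix

/-- **THE PRINTED ROUTE `γ₀ ≥ γ₀⁻`, as a predicate on one Hermitian matrix `H`** (Upadhyay et al. 2026,
§2: "one can instead obtain an exact lower bound on the gap `γ₀` by including the posterior error bound
of the first excited state … `γ₀ = E₁ − Ẽ₀ ≥ (Ẽ₁ − ‖r₁‖) − Ẽ₀ ≡ γ₀⁻`"): IF `H` is Hermitian THEN for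
every exact ground pair `(E₀, ψ₀)` (`Hψ₀ = E₀ψ₀`, `ψ₀ ≠ 0`, `E₀·⟨v,v⟩ ≤ Re⟨v,Hv⟩` for all `v`), every
two orthonormal Ritz vectors `u₀, u₁` of one search space (`⟨u₀, Hu₁⟩ = 0`: the `2 × 2` compression is
diagonal) with Ritz values `Ẽ₀ = Re⟨u₀,Hu₀⟩ ≤ Ẽ₁ = Re⟨u₁,Hu₁⟩`, and every eigenpair `(e, v)` with
`e ≠ E₀`: `Ẽ₁ − ‖r₁‖ ≤ e`, where `‖r₁‖ = √Re⟨r₁,r₁⟩`, `r₁ = Hu₁ − Ẽ₁u₁` (for a non-degenerate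
ground state exactly `γ₀ ≥ γ₀⁻`; in general IMPLIED by the printed sentence). A predicate (nothing
asserted); it FAILS for `H = diag(0,1,2)` (`not_excitedRitzResidualGapRoute_threeLevel`), hence not for
all `H` (`not_forall_excitedRitzResidualGapRoute`). [cite: UpadhyayEtAl2026, §2 eq. (γ₀ ≥ γ₀⁻), chunk p0005 L12–L16] -/
def ExcitedRitzResidualGapRoute (n : ℕ) (H : Matrix (Fin n) (Fin n) ℂ) : Prop :=
  H.IsHermitian →
  ∀ (E₀ : ℝ) (ψ₀ : Fin n → ℂ), ψ₀ ≠ 0 → H *ᵥ ψ₀ = (E₀ : ℂ) • ψ₀ →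
    (∀ v : Fin n → ℂ, E₀ * (star v ⬝ᵥ v).re ≤ (star v ⬝ᵥ H *ᵥ v).re) →
  ∀ (u₀ u₁ : Fin n → ℂ), star u₀ ⬝ᵥ u₀ = 1 → star u₁ ⬝ᵥ u₁ = 1 → star u₀ ⬝ᵥ u₁ = 0 →
    star u₀ ⬝ᵥ H *ᵥ u₁ = 0 → (star u₀ ⬝ᵥ H *ᵥ u₀).re ≤ (star u₁ ⬝ᵥ H *ᵥ u₁).re →
  ∀ (e : ℝ) (v : Fin n → ℂ), v ≠ 0 → H *ᵥ v = (e : ℂ) • v → e ≠ E₀ →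
    (star u₁ ⬝ᵥ H *ᵥ u₁).re -
        √((star (H *ᵥ u₁ - (((star u₁ ⬝ᵥ H *ᵥ u₁).re : ℝ) : ℂ) • u₁) ⬝ᵥ
            (H *ᵥ u₁ - (((star u₁ ⬝ᵥ H *ᵥ u₁).re : ℝ) : ℂ) • u₁)).re) ≤ e

/-- **BARRIER `ExcitedRitzResidualNotGapCertificate`.** A Rayleigh–Ritz (Davidson / Krylov / selected-CI)
space can return two EXACT eigenpairs — both residuals ZERO — while an eigenvalue of the same matrix lies
STRICTLY BETWEEN them: there are a Hermitian `H` on `ℂ³`, an exact non-degenerate-bottom ground pair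
`(0, ψ₀)`, a unit `u₁ ⟂ ψ₀` with `⟨ψ₀, Hu₁⟩ = 0` and `Hu₁ = 2u₁` (so `Ẽ₁ = 2`, `r₁ = 0`,
`γ₀⁻ = Ẽ₁ − ‖r₁‖ − Ẽ₀ = 2`), and a unit eigenvector `v` with `Hv = 1·v`, `1 ≠ 0 = E₀` (so
`γ₀ = E₁ − E₀ ≤ 1 < γ₀⁻`).

technique_class: taking the gap point `β` of a Temple / Kato / "gap-theorem" LOWER bound from the computation's OWN excited-state data — `β := Ẽ₁ − ‖r₁‖` from the second Davidson/Lanczos root and its residual ("posterior error bound of the first excited state"), or `β :=` the second root of a state-averaged DMRG / a 2-root selected CI minus its residual norm — and calling the resulting bracket `Ẽ₀ − ‖r‖²/(β − Ẽ₀) ≤ E₀` rigorous / exact / certified.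
blocks: route or oracle steps of the shape "`γ₀⁻ = (Ẽ₁ − ‖r₁‖) − Ẽ₀` is an exact lower bound on the gap, hence `Ẽ₀ − ‖r‖²/γ₀⁻ ≤ E₀` is a certified lower row" [cite: UpadhyayEtAl2026, §2 eq. (γ₀ ≥ γ₀⁻), chunk p0005 L12–L16]; in LADDER-CHEM: discharging `GapCertificate F a b β` (door M1, `Rows/TempleLowerRow.lean`) from residual data of Ritz pairs alone, at any rung (CI, MPS, SA-DMRG second root `Δ₁ [float]`).
because: a residual bound locates an eigenvalue NEAR each Ritz value (`|e − Ẽ₁| ≤ ‖r₁‖` for SOME eigenvalue `e` — Weinstein; Kahan: `k` eigenvalues within `‖R‖` of `k` Ritz values) but never EXCLUDES further eigenvalues below; `E₁ ≥ Ẽ₁ − ‖r₁‖` needs the count "exactly one eigenvalue (with multiplicity) of the sector lies below `Ẽ₁ − ‖r₁‖`", which is spectral information of the same kind as the gap itself; Cauchy interlacing supplies only `E₁ ≤ Ẽ₁`. The witness below has ZERO residuals, so no strengthening of the residual arithmetic (exact residuals, interval norms, more Davidson iterations on the same space) repairs the step [cite: UpadhyayEtAl2026, §2, chunk p0005 L3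–L26].
evasions_known: (i) CERTIFY THE INDEX: a certified LOWER row `ℓ` of the level-shifted file `Ĥ + λ|v⟩⟨v|` (or a form bound of `Ĥ` on `sector ∩ v^⊥`) gives `GapCertificate F a b β` — tree `Summit.Ventures.CertifiedQuantumChemistry.gapCertificate_of_lowerRow_levelShift` (`Rows/LevelShiftGapRows.lean`), `Rows/GapCertificateCodimOne.lean`; an `LDLᴴ` inertia count of `Ĥ_sector − β` (exactly one negative pivot) is the same certificate in direct form; intermediate-problem / Weinstein–Stenger–Bazley lower bounds to `E₁` likewise; (ii) USE the surrogate HONESTLY: `β` from an excited root (or a CISD gap estimate, as the primary Shayit et al. 2025 does) labels the bracket `rigorous modulo (β-index hypothesis)` / screening-grade — the venture's `Δ₁ [float]` triage column — never `certified`; (iii) a certified SDP/SOS lower bound `L ≤ E₀` needs no gap at all (the venture's `LowerCertificate` rows), and Temple with a certified `β` from (i) closes the bracket.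
scope_caveats: the obstruction is to the INFERENCE `residuals ⇒ β`, not to Temple's inequality (PROVED in the tree: `templeInequality_holds`) nor to Weinstein's enclosure (`exists_eigenOn_abs_sub_le_sqrt`); when an independent argument shows the search space contains approximations to ALL states below `Ẽ₁ − ‖r₁‖` (e.g. a certified eigenvalue count), `γ₀⁻` IS a valid gap bound — that argument is exactly evasion (i); the witness is real-diagonal `3 × 3`, so the failure is not an artefact of complex arithmetic, degeneracy (all three eigenvalues simple) or rounding (all residuals exactly zero).
status: established (theorem `ExcitedRitzResidualNotGapCertificate_holds`; refutation `not_forall_excitedRitzResidualGapRoute`; printed sentence [cite: UpadhyayEtAl2026, §2, chunk p0005 L12–L16]; analysis chem-lit-2 FRESHNESS-CHEM §2.12 J4 (ii)).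
[cite: UpadhyayEtAl2026, §2 eq. (γ₀ ≥ γ₀⁻), chunk p0005 L12–L16] -/
def ExcitedRitzResidualNotGapCertificate : Prop :=
  ∃ (H : Matrix (Fin 3) (Fin 3) ℂ) (ψ₀ u₁ v : Fin 3 → ℂ),
    H.IsHermitian ∧
    -- exact ground pair `(E₀, ψ₀) = (0, ψ₀)` at the bottom of the spectrum (zero residual)
    star ψ₀ ⬝ᵥ ψ₀ = 1 ∧ H *ᵥ ψ₀ = ((0 : ℝ) : ℂ) • ψ₀ ∧
    (∀ w : Fin 3 → ℂ, (0 : ℝ) * (star w ⬝ᵥ w).re ≤ (star w ⬝ᵥ H *ᵥ w).re) ∧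
    -- second Ritz pair `(Ẽ₁, u₁) = (2, u₁)` of the search space `span{ψ₀, u₁}`: orthonormal,
    -- compression diagonal, and EXACT (zero residual `r₁ = Hu₁ − 2u₁ = 0`)
    star u₁ ⬝ᵥ u₁ = 1 ∧ star ψ₀ ⬝ᵥ u₁ = 0 ∧ star ψ₀ ⬝ᵥ H *ᵥ u₁ = 0 ∧
    H *ᵥ u₁ = ((2 : ℝ) : ℂ) • u₁ ∧ (star u₁ ⬝ᵥ H *ᵥ u₁).re = 2 ∧
    -- yet an eigenvalue `1 ≠ E₀` lies strictly below `γ₀⁻ + Ẽ₀ = Ẽ₁ − ‖r₁‖ = 2`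
    star v ⬝ᵥ v = 1 ∧ H *ᵥ v = ((1 : ℝ) : ℂ) • v ∧ (1 : ℝ) ≠ 0 ∧ (1 : ℝ) < 2 - √0

/-! ### The three-level witness `H = diag(0, 1, 2)`, search space `span{e₀, e₂}` -/

namespace ThreeLevel

/-- The witness Hamiltonian `diag(0, 1, 2)` on `ℂ³`. [cite: UpadhyayEtAl2026, §2, chunk p0005 L12–L16] -/
def ham : Matrix (Fin 3) (Fin 3) ℂ := Matrix.diagonal ![(0 : ℂ), 1, 2]

/-- `e₀` — the exact ground state, first Ritz vector. [cite: UpadhyayEtAl2026, §2, chunk p0005 L12–L16] -/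
def e0 : Fin 3 → ℂ := ![1, 0, 0]

/-- `e₁` — the eigenvector (eigenvalue `1`) the search space misses. [cite: UpadhyayEtAl2026, §2, chunk p0005 L12–L16] -/
def e1 : Fin 3 → ℂ := ![0, 1, 0]

/-- `e₂` — the second Ritz vector (exact, eigenvalue `2`). [cite: UpadhyayEtAl2026, §2, chunk p0005 L12–L16] -/
def e2 : Fin 3 → ℂ := ![0, 0, 1]

/-- `diag(0, 1, 2)` is Hermitian. [folklore] -/
private theorem ham_isHermitian : ham.IsHermitian := by
  unfold ham
  rw [Matrix.IsHermitian, Matrix.diagonal_conjTranspose]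
  congr 1
  ext i
  fin_cases i <;> simp

/-- The energy form of the witness: `Re⟨w, Hw⟩ = |w₁|² + 2|w₂|²`. [folklore] -/
private theorem re_form_ham (w : Fin 3 → ℂ) : (star w ⬝ᵥ ham *ᵥ w).re = ‖w 1‖ ^ 2 + 2 * ‖w 2‖ ^ 2 := by
  have hss : ∀ z : ℂ, (starRingEnd ℂ) z * z = ((‖z‖ ^ 2 : ℝ) : ℂ) := fun z => by
    rw [← Complex.normSq_eq_conj_mul_self, Complex.normSq_eq_norm_sq]
  simp only [ham, dotProduct, mulVec_diagonal, Fin.sum_univ_three, Pi.star_apply, Complex.star_def,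
    Matrix.cons_val_zero, Matrix.cons_val_one, Matrix.cons_val_two, Matrix.head_cons,
    Matrix.tail_cons, zero_mul, mul_zero, zero_add, one_mul]
  rw [show (starRingEnd ℂ) (w 2) * (2 * w 2) = 2 * ((starRingEnd ℂ) (w 2) * w 2) by ring, hss, hss]
  simp only [Complex.add_re, Complex.mul_re, Complex.ofReal_re, Complex.ofReal_im, mul_zero, sub_zero,
    Complex.re_ofNat, Complex.im_ofNat]

/-- `H e₀ = 0·e₀`. [folklore] -/
private theorem ham_mulVec_e0 : ham *ᵥ e0 = ((0 : ℝ) : ℂ) • e0 := by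
  funext i
  fin_cases i <;> simp [ham, e0, mulVec_diagonal]

/-- `H e₁ = 1·e₁`. [folklore] -/
private theorem ham_mulVec_e1 : ham *ᵥ e1 = ((1 : ℝ) : ℂ) • e1 := by
  funext i
  fin_cases i <;> simp [ham, e1, mulVec_diagonal]

/-- `H e₂ = 2·e₂`. [folklore] -/
private theorem ham_mulVec_e2 : ham *ᵥ e2 = ((2 : ℝ) : ℂ) • e2 := by
  funext i
  fin_cases i <;> simp [ham, e2, mulVec_diagonal]

/-- `Re⟨e₂, He₂⟩ = 2`. [folklore] -/
private theorem re_form_e2 : (star e2 ⬝ᵥ ham *ᵥ e2).re = 2 := by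
  rw [re_form_ham]
  simp [e2]

/-- `Re⟨e₀, He₀⟩ = 0`. [folklore] -/
private theorem re_form_e0 : (star e0 ⬝ᵥ ham *ᵥ e0).re = 0 := by
  rw [re_form_ham]
  simp [e0]

end ThreeLevel

open ThreeLevel in
/-- **The barrier holds** (PROVED; witness `H = diag(0,1,2)`, `ψ₀ = e₀`, `u₁ = e₂`, `v = e₁`).
[cite: UpadhyayEtAl2026, §2 eq. (γ₀ ≥ γ₀⁻), chunk p0005 L12–L16] -/
theorem ExcitedRitzResidualNotGapCertificate_holds : ExcitedRitzResidualNotGapCertificate := by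
  refine ⟨ham, e0, e2, e1, ham_isHermitian, ?_, ham_mulVec_e0, ?_, ?_, ?_, ?_, ham_mulVec_e2,
    re_form_e2, ?_, ham_mulVec_e1, one_ne_zero, ?_⟩
  · simp [e0, dotProduct, Fin.sum_univ_three]
  · intro w
    rw [re_form_ham, zero_mul]
    positivity
  · simp [e2, dotProduct, Fin.sum_univ_three]
  · simp [e0, e2, dotProduct, Fin.sum_univ_three]
  · rw [ham_mulVec_e2]
    simp [e0, e2, dotProduct, Fin.sum_univ_three]
  · simp [e1, dotProduct, Fin.sum_univ_three]
  · rw [Real.sqrt_zero]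
    norm_num

open ThreeLevel in
/-- **REFUTATION OF THE PRINTED ROUTE AT THE WITNESS.** `γ₀ ≥ γ₀⁻` fails for `H = diag(0,1,2)`: the
premises of `ExcitedRitzResidualGapRoute 3 H` hold with `(E₀, ψ₀) = (0, e₀)`, `(u₀, u₁) = (e₀, e₂)`
(Ritz values `0 ≤ 2`, both residuals zero) and the eigenpair `(1, e₁)`, `1 ≠ 0`, but the conclusion
reads `2 − √0 ≤ 1`. [cite: UpadhyayEtAl2026, §2 eq. (γ₀ ≥ γ₀⁻), chunk p0005 L12–L16] -/
theorem not_excitedRitzResidualGapRoute_threeLevel : ¬ ExcitedRitzResidualGapRoute 3 ham := by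
  intro h
  have h00 : star e0 ⬝ᵥ e0 = 1 := by simp [e0, dotProduct, Fin.sum_univ_three]
  have h22 : star e2 ⬝ᵥ e2 = 1 := by simp [e2, dotProduct, Fin.sum_univ_three]
  have h02 : star e0 ⬝ᵥ e2 = 0 := by simp [e0, e2, dotProduct, Fin.sum_univ_three]
  have hH02 : star e0 ⬝ᵥ ham *ᵥ e2 = 0 := by
    rw [ham_mulVec_e2]
    simp [e0, e2, dotProduct, Fin.sum_univ_three]
  have he0 : e0 ≠ 0 := fun h0 => by simpa [e0] using congr_fun h0 0
  have he1 : e1 ≠ 0 := fun h0 => by simpa [e1] using congr_fun h0 1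
  have hground : ∀ w : Fin 3 → ℂ, (0 : ℝ) * (star w ⬝ᵥ w).re ≤ (star w ⬝ᵥ ham *ᵥ w).re := by
    intro w
    rw [re_form_ham, zero_mul]
    positivity
  have hord : (star e0 ⬝ᵥ ham *ᵥ e0).re ≤ (star e2 ⬝ᵥ ham *ᵥ e2).re := by
    rw [re_form_e0, re_form_e2]
    norm_num
  have key := h ham_isHermitian 0 e0 he0 ham_mulVec_e0 hground e0 e2 h00 h22 h02 hH02 hord
    1 e1 he1 ham_mulVec_e1 one_ne_zero
  have hres : ham *ᵥ e2 - (((star e2 ⬝ᵥ ham *ᵥ e2).re : ℝ) : ℂ) • e2 = 0 := by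
    rw [re_form_e2, ham_mulVec_e2, sub_eq_zero]
  rw [hres, re_form_e2] at key
  norm_num [star_zero, dotProduct_zero, Complex.zero_re, Real.sqrt_zero, sub_zero] at key

/-- **REFUTATION OF THE PRINTED ROUTE** (universal form): it is NOT the case that every finite Hermitian
matrix obeys `γ₀ ≥ γ₀⁻` — the form a route card or a referee protocol cites ("`β := Ẽ₁ − ‖r₁‖` is not a
certificate input"). [cite: UpadhyayEtAl2026, §2 eq. (γ₀ ≥ γ₀⁻), chunk p0005 L12–L16] -/
theorem not_forall_excitedRitzResidualGapRoute :
    ¬ ∀ (n : ℕ) (H : Matrix (Fin n) (Fin n) ℂ), ExcitedRitzResidualGapRoute n H :=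
  fun h => not_excitedRitzResidualGapRoute_threeLevel (h 3 ThreeLevel.ham)

end Literature.Barriers.CertifiedQuantumChemistry
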